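import Summits.BirchSwinnertonDyer.BirchSwinnertonDyer.Theorems.EdixhovenFibreFiveSevenStarredOptimalManinUnitFiveSevenOfHasDualExp
import Literature.NumberTheory.PAdicHodge.TateH1BdRFilOfTS1
import Literature.NumberTheory.PAdicHodge.PerfectoidFiniteExtensionsCyclotomic
import HarnessLib

/-!
# Route `EdixhovenFibreFiveSeven`, crux K★ `StarredOptimalManinUnitFiveSeven` (stmt-BirchSwinnertonDyer-22226): the conditional
# closer RE-KEYED on Tate's (TS1) — Kato II §1.2.7 (`H¹(Γ_F, B^m_dR)`) is now a tree theorem modulo (TS1)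

Cell `pub/bsd-wall`, seat `bsd-line-edix-p4` g6 (line `kato-lever`, b7-top). The previous closer
(`starredOptimalManinUnitFiveSeven_of_sl2NeronValues_of_kato1993_H1_bdRFil`, seat g5) displayed the cite-only fact
`kato1993_H1_bdRFil` (Kato LNM 1553 II §1.2.7 for `V = ℚ_p`: `H¹(K, B^m_dR) = K log χ` / `0` on cocycles of finite type).
That fact is now PROVED modulo the single named fact (TS1) `tate1967_TS1_completedAlgClosure` (Tate 1967 §3.2 Prop. 9):
`Literature.NumberTheory.PAdicHodge.BdRH1Devissage.kato1993_H1_bdRFil_of_TS1` (file `TateH1BdRFilOfTS1`: Kato's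
`t`-adic dévissage with the continuity of the `Γ_F`-action on `B_dR⁺` for Fontaine's topology, files
`AinfGaloisContinuity`, `BdRPlusGaloisContinuity`). Hence F″ and K★ are re-keyed on the binder set
{P1, hT₂ (S5b-tower), (TS1), hDR}:

* `KatoAssemblySocket.kato_neron_five_le_of_sl2NeronValues_of_TS1 (hT₂) (hTS1) (hDR) (hP1) : F″`;
* `starredOptimalManinUnitFiveSeven_of_sl2NeronValues_of_TS1 (hT₂) (hTS1) (hDR) (hP1) : K★`.

CONDITIONAL RESULT (gate audit `proof.conditional`): (TS1), P1, hT₂, hDR remain cite-only; the item stays OPEN; BSD is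
not proved by any of this.
-/

set_option autoImplicit false
-- the Theorems namespace of a single-conjunct summit repeats the summit name by design (D-0017)
set_option linter.dupNamespace false

noncomputable section

namespace Summit.BirchSwinnertonDyer.BirchSwinnertonDyer.Theorems

/-- **F″ ⟸ P1 + (S5b-tower) + (TS1) + de Rham**: Kato's Néron integrality of twisted symbol sums at additive `p ≥ 5`
(`kato_neron_isIntegral_twistedSymbolSum_of_additive_five_le`), through `kato_neron_five_le_of_sl2NeronValues_of_hasDualExp`
with its hP′ binder (Kato II Prop. 1.2.3 for every de Rham `V`) fed by the tree theorem `hasDualExp_of_isDeRham_of_TS1`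
(filtered comparison + `t`-adic dévissage + continuity of `Γ_F` on `B_dR⁺`, all proved; Tate's (TS1) granted).
[cite: Kato2004Asterisque, (8.1.3) (p. 180), Thm. 9.7 (p. 189), Thm. 6.6 (1) (p. 163), Thm. 13.6 (p. 227)]
[cite: Kato1993LNM1553, Ch. II Prop. 1.2.3, §1.2.5–1.2.7 and Thm. 1.4.1 (3)-(4)] [cite: Tate1967, §3.2 Prop. 9, §3.3 Theorems 1–2] -/
theorem KatoAssemblySocket.kato_neron_five_le_of_sl2NeronValues_of_TS1
    (hT₂ : Literature.NumberTheory.PAdicHodge.exists_smul_range_expStarCoord_tower_iff_trace_log)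
    (hTS1 : Literature.NumberTheory.PAdicHodge.tate1967_TS1_completedAlgClosure)
    (hDR : Literature.NumberTheory.PAdicHodge.isDeRham_restrictedRationalTateRep)
    (hP1 : Literature.NumberTheory.EllipticCurves.Kato2004.exists_member_sl2ZetaElement_neron_values) :
    Literature.NumberTheory.EllipticCurves.kato_neron_isIntegral_twistedSymbolSum_of_additive_five_le :=
  KatoAssemblySocket.kato_neron_five_le_of_sl2NeronValues_of_hasDualExp hT₂
    (Literature.NumberTheory.PAdicHodge.BdRH1Devissage.hasDualExp_of_isDeRham_of_TS1 hTS1) hDR hP1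

/-- **K★ ⟸ P1 + (S5b-tower) + (TS1) + de Rham** (conditional closer of stmt-BirchSwinnertonDyer-22226, re-keyed on Tate's
(TS1)): Manin's `p`-part at the lattice-optimal datum of an `X₀(N)`-optimal curve of starred additive type at `p ∈ {5, 7}`
with `E[p]` irreducible — `starredOptimalManinUnitFiveSeven_of_sl2NeronValues_of_hasDualExp` ∘ `hasDualExp_of_isDeRham_of_TS1`.
Neither Kato II Prop. 1.2.3 nor its §1.2.7 input is assumed any more: only Tate's almost-étale condition (TS1) is.
[cite: Kato2004Asterisque, (8.1.3) (p. 180), Thm. 9.7 (p. 189), Thm. 6.6 (1) (p. 163), Thm. 13.6 (p. 227)]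
[cite: Kato1993LNM1553, Ch. II §1.2.5–1.2.7 and Thm. 1.4.1 (3)-(4)] [cite: EdixhovenManin1991, Thm. 3 and §4] [cite: Tate1967, §3.2 Prop. 9] -/
theorem starredOptimalManinUnitFiveSeven_of_sl2NeronValues_of_TS1
    (hT₂ : Literature.NumberTheory.PAdicHodge.exists_smul_range_expStarCoord_tower_iff_trace_log)
    (hTS1 : Literature.NumberTheory.PAdicHodge.tate1967_TS1_completedAlgClosure)
    (hDR : Literature.NumberTheory.PAdicHodge.isDeRham_restrictedRationalTateRep)
    (hP1 : Literature.NumberTheory.EllipticCurves.Kato2004.exists_member_sl2ZetaElement_neron_values) :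
    Summit.BirchSwinnertonDyer.BirchSwinnertonDyer.Theses.EdixhovenFibreFiveSeven.StarredOptimalManinUnitFiveSeven :=
  starredOptimalManinUnitFiveSeven_of_sl2NeronValues_of_hasDualExp hT₂
    (Literature.NumberTheory.PAdicHodge.BdRH1Devissage.hasDualExp_of_isDeRham_of_TS1 hTS1) hDR hP1

/-! ### Appended: the same closers keyed on Scholze 2012 Thm. 3.7 (i) (edix-p1's `tate1967_TS1_of_scholze2012`) -/

/-- **F″ ⟸ P1 + (S5b-tower) + Scholze 2012 Thm. 3.7 (i) + de Rham**: (TS1) itself is the tree theorem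
`TateAlmostEtale.tate1967_TS1_of_scholze2012` (Kummer route of seat edix-p1: p-primary part, Sylow plumbing, bridge all
proved; cited: finite extensions of the perfectoid field `ℚ_p(μ_{p^∞})^` are perfectoid). CONDITIONAL RESULT.
[cite: Kato2004Asterisque, (8.1.3) (p. 180), Thm. 9.7 (p. 189), Thm. 13.6 (p. 227)] [cite: Scholze2012, Thm. 3.7 (i)] -/
theorem KatoAssemblySocket.kato_neron_five_le_of_sl2NeronValues_of_scholze2012
    (hT₂ : Literature.NumberTheory.PAdicHodge.exists_smul_range_expStarCoord_tower_iff_trace_log)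
    (hS : Literature.NumberTheory.PAdicHodge.scholze2012_frobeniusSurjective_finite_over_Kinf)
    (hDR : Literature.NumberTheory.PAdicHodge.isDeRham_restrictedRationalTateRep)
    (hP1 : Literature.NumberTheory.EllipticCurves.Kato2004.exists_member_sl2ZetaElement_neron_values) :
    Literature.NumberTheory.EllipticCurves.kato_neron_isIntegral_twistedSymbolSum_of_additive_five_le :=
  KatoAssemblySocket.kato_neron_five_le_of_sl2NeronValues_of_TS1 hT₂
    (Literature.NumberTheory.PAdicHodge.TateAlmostEtale.tate1967_TS1_of_scholze2012 hS) hDR hP1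

/-- **K★ ⟸ P1 + (S5b-tower) + Scholze 2012 Thm. 3.7 (i) + de Rham** (conditional closer of stmt-BirchSwinnertonDyer-22226
with the whole p-adic Hodge input — Kato II Prop. 1.2.3, §1.2.7, Tate–Sen (TS1) — reduced to one cite of Scholze's almost
purity for `ℚ_p(μ_{p^∞})^`). CONDITIONAL; the item is not closed by this.
[cite: Kato2004Asterisque, (8.1.3) (p. 180), Thm. 9.7 (p. 189)] [cite: EdixhovenManin1991, Thm. 3 and §4] [cite: Scholze2012, Thm. 3.7 (i)] -/
theorem starredOptimalManinUnitFiveSeven_of_sl2NeronValues_of_scholze2012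
    (hT₂ : Literature.NumberTheory.PAdicHodge.exists_smul_range_expStarCoord_tower_iff_trace_log)
    (hS : Literature.NumberTheory.PAdicHodge.scholze2012_frobeniusSurjective_finite_over_Kinf)
    (hDR : Literature.NumberTheory.PAdicHodge.isDeRham_restrictedRationalTateRep)
    (hP1 : Literature.NumberTheory.EllipticCurves.Kato2004.exists_member_sl2ZetaElement_neron_values) :
    Summit.BirchSwinnertonDyer.BirchSwinnertonDyer.Theses.EdixhovenFibreFiveSeven.StarredOptimalManinUnitFiveSeven :=
  starredOptimalManinUnitFiveSeven_of_sl2NeronValues_of_TS1 hT₂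
    (Literature.NumberTheory.PAdicHodge.TateAlmostEtale.tate1967_TS1_of_scholze2012 hS) hDR hP1

end Summit.BirchSwinnertonDyer.BirchSwinnertonDyer.Theorems

end
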